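import Mathlib.Analysis.Normed.Field.Basic
import Mathlib.Tactic.Positivity
import Mathlib.Tactic.Linarith

/-!
# `MatrixDescartes` census — PROPOSITION κ*: the closed form of the Newton-good criterion on the six low knots

HONEST FRAMING.  Object-search cell `pub-symmetroid`, route crux `Theses.LacunarySymmetroid.MatrixDescartes`
(ledger item stmt-ValiantsHypothesis-18050).  Kernel form of engine-1 g14's **PROPOSITION κ*** (THEOREM-LN-E1G14.md §7;
READER PASS ×2: theory-2 g15 exact code, theory g16 by hand): on the six low knots `(0, d₁, d₂, 2d₁, d₁+d₂, 2d₂)` of a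
class-G support (`d₁ < d₂ < 2d₁`) the weights `π_k = ∏_{i≠k} |e_k − e_i|` are explicit polynomials and the quantity
`M^{low} = π₀π₁π₄² − π₀π₂π₃π₄ − π₁π₂²π₃` of THEOREM L-N (a) (kernel: `Census.newton_s0_window`, hypothesis
`π₀π₂π₃π₄ + π₁π₂²π₃ ≤ π₀π₁π₄²`, file `…CensusNewtonS0.lean`) factors as
`M^{low} = 36 · d₁⁸ d₂⁵ (d₂ − d₁)⁵ (5d₂² − 5d₁d₂ − d₁²)` — so the 6-term window is Newton-good iff
`5(d₂/d₁)² − 5(d₂/d₁) − 1 ≥ 0`, i.e. `d₂/d₁ ≥ κ* = (5 + 3√5)/10 ≈ 1.1708` (for `d₂ = d₁ + 1`: iff `d₁ ≤ 5`), which is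
engine-1's explanation of the «census road d₁ ≤ 5 Newton-good / κ-corner d₁ ≥ 6 never» split.
* `kappaStar_identity` — the polynomial identity (`ring`), with the `π_k` written as the explicit products of the
  (positive) knot differences;  * `kappaStar_nonneg_iff` — for `0 < d₁ < d₂ < 2d₁`: `M^{low} ≥ 0 ↔ 5d₂² − 5d₁d₂ − d₁² ≥ 0`.
Nothing here bears on `ζ_sym`, `DoorA26` / `DoorA34`, the crux, or `VP ≠ VNP`.  [folklore] algebra.
-/

-- `Summit.ValiantsHypothesis.ValiantsHypothesis.…` repeats a component by the D-0017 layout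
-- (single-conjunct summit), which the `dupNamespace` linter flags; the name is mandated.
set_option linter.dupNamespace false

namespace Summit.ValiantsHypothesis.ValiantsHypothesis.Theorems.LacunarySymmetroidMatrixDescartes.Census

/-- **PROPOSITION κ* — identity.**  With the six low knots `e = (0, d₁, d₂, 2d₁, d₁+d₂, 2d₂)` (class G: every
difference below is positive) and `π₀ = d₁·d₂·2d₁·(d₁+d₂)·2d₂`, `π₁ = d₁·(d₂−d₁)·d₁·d₂·(2d₂−d₁)`,
`π₂ = d₂·(d₂−d₁)·(2d₁−d₂)·d₁·d₂`, `π₃ = 2d₁·d₁·(2d₁−d₂)·(d₂−d₁)·(2d₂−2d₁)`, `π₄ = (d₁+d₂)·d₂·d₁·(d₂−d₁)·(d₂−d₁)`: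
`π₀π₁π₄² − π₀π₂π₃π₄ − π₁π₂²π₃ = 36 d₁⁸ d₂⁵ (d₂−d₁)⁵ (5d₂² − 5d₁d₂ − d₁²)`. (engine-1 g14 PROPOSITION κ*; reader PASS
theory-2 g15, theory g16.) [folklore] -/
theorem kappaStar_identity (d₁ d₂ : ℝ) :
    (d₁ * d₂ * (2 * d₁) * (d₁ + d₂) * (2 * d₂)) * (d₁ * (d₂ - d₁) * d₁ * d₂ * (2 * d₂ - d₁))
        * ((d₁ + d₂) * d₂ * d₁ * (d₂ - d₁) * (d₂ - d₁)) ^ 2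
      - (d₁ * d₂ * (2 * d₁) * (d₁ + d₂) * (2 * d₂)) * (d₂ * (d₂ - d₁) * (2 * d₁ - d₂) * d₁ * d₂)
        * (2 * d₁ * d₁ * (2 * d₁ - d₂) * (d₂ - d₁) * (2 * d₂ - 2 * d₁))
        * ((d₁ + d₂) * d₂ * d₁ * (d₂ - d₁) * (d₂ - d₁))
      - (d₁ * (d₂ - d₁) * d₁ * d₂ * (2 * d₂ - d₁)) * (d₂ * (d₂ - d₁) * (2 * d₁ - d₂) * d₁ * d₂) ^ 2
        * (2 * d₁ * d₁ * (2 * d₁ - d₂) * (d₂ - d₁) * (2 * d₂ - 2 * d₁))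
    = 36 * d₁ ^ 8 * d₂ ^ 5 * (d₂ - d₁) ^ 5 * (5 * d₂ ^ 2 - 5 * d₁ * d₂ - d₁ ^ 2) := by
  ring

/-- **PROPOSITION κ* — criterion.**  For `0 < d₁ < d₂` (the class-G order `d₂ < 2d₁` is not even needed for the
sign) the quantity of `kappaStar_identity` is `≥ 0` iff `5d₂² − 5d₁d₂ − d₁² ≥ 0` (iff `d₂/d₁ ≥ (5+3√5)/10`). [folklore] -/
theorem kappaStar_nonneg_iff {d₁ d₂ : ℝ} (h1 : 0 < d₁) (h12 : d₁ < d₂) :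
    0 ≤ 36 * d₁ ^ 8 * d₂ ^ 5 * (d₂ - d₁) ^ 5 * (5 * d₂ ^ 2 - 5 * d₁ * d₂ - d₁ ^ 2)
      ↔ 0 ≤ 5 * d₂ ^ 2 - 5 * d₁ * d₂ - d₁ ^ 2 := by
  have hpos : 0 < 36 * d₁ ^ 8 * d₂ ^ 5 * (d₂ - d₁) ^ 5 := by
    have : 0 < d₂ - d₁ := by linarith
    have : 0 < d₂ := by linarith
    positivity
  constructor
  · intro h
    by_contra hc
    rw [not_le] at hc
    have := mul_neg_of_pos_of_neg hpos hc
    linarith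
  · intro h
    exact mul_nonneg hpos.le h

end Summit.ValiantsHypothesis.ValiantsHypothesis.Theorems.LacunarySymmetroidMatrixDescartes.Census
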